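import Summits.FinalStateConjecture.FinalStateConjecture.Theorems.EIHFluxBalanceInertialRecessionStubEndgameBasics

/-!
# Route EIHFluxBalance — crux `InertialRecession`, abstract endgame for general `N`:
# the kinematic CLUSTER LAW on a constant window (window law + identification ⇒ quasi-conserved cluster 4-momentum)

Helper file for the crux `stmt-FinalStateConjecture-10166` (virial route, evidence note
`InertialRecession_endgame_generalN_virial.md`, §1 "cluster law" / FACT 1), in the vocabulary of `stub_pairwiseDichotomy` (line
`sublinear-is-free-clean-window-charges`): the window law `hWL` and the identification `hID`, specialised to one pair `(ρ, δ)` (their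
`∃ C T` / `∃ T ζ` witnesses taken as data), and bodies that move at speed `≤ 1`.

* `clusterLaw_constPath` — if at time `t ≥ T` a member set `A` is `2δ`-CLEAR in the window `(c, R)` (members within `(1 − 2δ)R`,
  non-members beyond `(1 + 2δ)R`), the window satisfies the cone condition at `t` and `ρ ≤ δR` on `[t, t + δR]`, then for every
  `s ∈ [t, t + δR]` the KINEMATIC cluster charges `Σ_{j∈A} Mⱼγⱼ` and `Σ_{j∈A} Mⱼγⱼvⱼ` change between `t` and `s` by at most
  `C·(s − t)·R^{-3/2} + ζ t + ζ s`: the constant path `(c, R)` stays `δ`-admissible (bodies move `≤ δR`), the window law bounds the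
  abstract charge SHARPLY, and identification at the two ends converts to kinematics (the rate-free `ζ` is paid exactly twice).
-/

noncomputable section

set_option linter.dupNamespace false

open Finset Set MeasureTheory intervalIntegral

namespace Summit.FinalStateConjecture.FinalStateConjecture.Theorems.SublinearIsFree.Virial

open Literature.Geometry.Lorentzian

/-- **Cluster law on a constant window path.** See the module docstring. The hypotheses `hWL`/`hID` are those of
`stub_pairwiseDichotomy` for a fixed `(ρ, δ)` with their existential witnesses `C, T` and `T, ζ` exposed (use the later of the two
`T`'s). [folklore] -/
theorem clusterLaw_constPath' {N : ℕ} (M : Fin N → ℝ) (ξ v : Fin N → ℝ → E3) (κ : ℝ) (P : ℝ → E3 → ℝ → Fin 4 → ℝ)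
    {δ C T : ℝ} {ρ ζ : ℝ → ℝ} (hδ : 0 < δ) (hκ : 0 ≤ κ)
    (hWL : ∀ (t₁ t₂ : ℝ) (c : ℝ → E3) (R : ℝ → ℝ), T ≤ t₁ → t₁ ≤ t₂ →
      (∀ s ∈ Set.Icc t₁ t₂, ∀ s' ∈ Set.Icc t₁ t₂, ‖c s - c s'‖ ≤ 2 * |s - s'| ∧ |R s - R s'| ≤ 2 * |s - s'|) →
      (∀ s ∈ Set.Icc t₁ t₂, ρ s ≤ δ * R s ∧ ‖c s‖ + R s ≤ (κ + κ ^ 2) / 2 * s ∧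
        ∀ j, ‖ξ j s - c s‖ ≤ (1 - δ) * R s ∨ (1 + δ) * R s ≤ ‖ξ j s - c s‖) →
      ∀ μ : Fin 4, |P t₂ (c t₂) (R t₂) μ - P t₁ (c t₁) (R t₁) μ| ≤ C * ∫ s in t₁..t₂, (R s ^ (3 / 2 : ℝ))⁻¹)
    (hID : ∀ (t : ℝ) (c : E3) (R : ℝ) (A : Finset (Fin N)), T ≤ t → ρ t ≤ δ * R →
      ‖c‖ + R ≤ (κ + κ ^ 2) / 2 * t →
      (∀ j, ‖ξ j t - c‖ ≤ (1 - δ) * R ∨ (1 + δ) * R ≤ ‖ξ j t - c‖) → (∀ j, j ∈ A ↔ ‖ξ j t - c‖ ≤ (1 - δ) * R) →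
      |P t c R 0 - ∑ j ∈ A, M j * (√(1 - ‖v j t‖ ^ 2))⁻¹| ≤ ζ t ∧
      ∀ k : Fin 3, |P t c R k.succ - ∑ j ∈ A, M j * (√(1 - ‖v j t‖ ^ 2))⁻¹ * v j t k| ≤ ζ t)
    (hmove : ∀ j (s s' : ℝ), T ≤ s → s ≤ s' → ‖ξ j s' - ξ j s‖ ≤ s' - s)
    {t R : ℝ} {c : E3} {A : Finset (Fin N)} (ht : T ≤ t) (hR : 0 < R)
    (hρ : ∀ s ∈ Set.Icc t (t + δ * R), ρ s ≤ δ * R)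
    (hcone : ‖c‖ + R ≤ (κ + κ ^ 2) / 2 * t)
    (hin : ∀ j ∈ A, ‖ξ j t - c‖ ≤ (1 - 2 * δ) * R) (hout : ∀ j ∉ A, (1 + 2 * δ) * R ≤ ‖ξ j t - c‖)
    {s : ℝ} (hs : s ∈ Set.Icc t (t + δ * R)) :
    |(∑ j ∈ A, M j * (√(1 - ‖v j s‖ ^ 2))⁻¹) - ∑ j ∈ A, M j * (√(1 - ‖v j t‖ ^ 2))⁻¹| ≤
        C * ((s - t) * (R ^ (3 / 2 : ℝ))⁻¹) + ζ t + ζ s ∧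
      ∀ k : Fin 3, |(∑ j ∈ A, M j * (√(1 - ‖v j s‖ ^ 2))⁻¹ * v j s k) -
          ∑ j ∈ A, M j * (√(1 - ‖v j t‖ ^ 2))⁻¹ * v j t k| ≤ C * ((s - t) * (R ^ (3 / 2 : ℝ))⁻¹) + ζ t + ζ s := by
  have hts : t ≤ s := hs.1
  have hsd : s ≤ t + δ * R := hs.2
  -- clearance persists on `[t, s]`: bodies move by at most `s' − t ≤ δR`
  have hclear : ∀ s' ∈ Set.Icc t s, ∀ j,
      (j ∈ A → ‖ξ j s' - c‖ ≤ (1 - δ) * R) ∧ (j ∉ A → (1 + δ) * R ≤ ‖ξ j s' - c‖) := by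
    intro s' hs' j
    have hmv : ‖ξ j s' - ξ j t‖ ≤ δ * R := by
      have := hmove j t s' ht hs'.1
      linarith [hs'.2]
    constructor
    · intro hj
      calc ‖ξ j s' - c‖ = ‖(ξ j s' - ξ j t) + (ξ j t - c)‖ := by rw [sub_add_sub_cancel]
        _ ≤ ‖ξ j s' - ξ j t‖ + ‖ξ j t - c‖ := norm_add_le _ _
        _ ≤ δ * R + (1 - 2 * δ) * R := add_le_add hmv (hin j hj)
        _ = (1 - δ) * R := by ring
    · intro hj
      have h1 := hout j hj
      have h2 : ‖ξ j t - c‖ ≤ ‖ξ j s' - c‖ + ‖ξ j s' - ξ j t‖ := by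
        calc ‖ξ j t - c‖ = ‖(ξ j s' - c) - (ξ j s' - ξ j t)‖ := by rw [sub_sub_sub_cancel_left]
          _ ≤ ‖ξ j s' - c‖ + ‖ξ j s' - ξ j t‖ := norm_sub_le _ _
      calc (1 + δ) * R = (1 + 2 * δ) * R - δ * R := by ring
        _ ≤ ‖ξ j t - c‖ - ‖ξ j s' - ξ j t‖ := by linarith
        _ ≤ ‖ξ j s' - c‖ := by linarith
  have hdisj : ∀ s' ∈ Set.Icc t s, ∀ j, ‖ξ j s' - c‖ ≤ (1 - δ) * R ∨ (1 + δ) * R ≤ ‖ξ j s' - c‖ := by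
    intro s' hs' j
    by_cases hj : j ∈ A
    · exact Or.inl ((hclear s' hs' j).1 hj)
    · exact Or.inr ((hclear s' hs' j).2 hj)
  have hmem : ∀ s' ∈ Set.Icc t s, ∀ j, j ∈ A ↔ ‖ξ j s' - c‖ ≤ (1 - δ) * R := by
    intro s' hs' j
    constructor
    · exact (hclear s' hs' j).1
    · intro hle
      by_contra hj
      have hge := (hclear s' hs' j).2 hj
      have : (1 + δ) * R ≤ (1 - δ) * R := hge.trans hle
      nlinarith
  -- the cone condition propagates forward in time
  have hcone' : ∀ s' ∈ Set.Icc t s, ‖c‖ + R ≤ (κ + κ ^ 2) / 2 * s' := by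
    intro s' hs'
    have h0 : 0 ≤ (κ + κ ^ 2) / 2 := by positivity
    calc ‖c‖ + R ≤ (κ + κ ^ 2) / 2 * t := hcone
      _ ≤ (κ + κ ^ 2) / 2 * s' := mul_le_mul_of_nonneg_left hs'.1 h0
  have hρ' : ∀ s' ∈ Set.Icc t s, ρ s' ≤ δ * R := fun s' hs' ↦ hρ s' ⟨hs'.1, hs'.2.trans hsd⟩
  -- window law on the constant path
  have hW := hWL t s (fun _ ↦ c) (fun _ ↦ R) ht hts
    (fun s₁ _ s₂ _ ↦ ⟨by simp, by simp⟩)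
    (fun s' hs' ↦ ⟨hρ' s' hs', hcone' s' hs', hdisj s' hs'⟩)
  have hint : ∫ _ in t..s, (R ^ (3 / 2 : ℝ))⁻¹ = (s - t) * (R ^ (3 / 2 : ℝ))⁻¹ := by
    rw [intervalIntegral.integral_const, smul_eq_mul]
  simp only [hint] at hW
  -- identification at both ends
  have hIt := hID t c R A ht (hρ' t ⟨le_rfl, hts⟩) hcone (hdisj t ⟨le_rfl, hts⟩) (hmem t ⟨le_rfl, hts⟩)
  have hIs := hID s c R A (ht.trans hts) (hρ' s ⟨hts, le_rfl⟩) (hcone' s ⟨hts, le_rfl⟩) (hdisj s ⟨hts, le_rfl⟩)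
    (hmem s ⟨hts, le_rfl⟩)
  constructor
  · have h0 := hW 0
    have h1 := hIt.1
    have h2 := hIs.1
    rw [abs_le] at h0 h1 h2 ⊢
    constructor <;> linarith [h0.1, h0.2, h1.1, h1.2, h2.1, h2.2]
  · intro k
    have h0 := hW k.succ
    have h1 := hIt.2 k
    have h2 := hIs.2 k
    rw [abs_le] at h0 h1 h2 ⊢
    constructor <;> linarith [h0.1, h0.2, h1.1, h1.2, h2.1, h2.2]

/-- Registered stub `clusterLaw_constPath` (crux `stmt-FinalStateConjecture-10166`): the kinematic cluster law on a constant window,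
one-line form of `clusterLaw_constPath'`. [folklore] -/
theorem clusterLaw_constPath : open Literature.Geometry.Lorentzian MeasureTheory intervalIntegral in ∀ {N : ℕ} (M : Fin N → ℝ) (ξ v : Fin N → ℝ → E3) (κ : ℝ) (P : ℝ → E3 → ℝ → Fin 4 → ℝ) {δ C T : ℝ} {ρ ζ : ℝ → ℝ}, 0 < δ → 0 ≤ κ → (∀ (t₁ t₂ : ℝ) (c : ℝ → E3) (R : ℝ → ℝ), T ≤ t₁ → t₁ ≤ t₂ → (∀ s ∈ Set.Icc t₁ t₂, ∀ s' ∈ Set.Icc t₁ t₂, ‖c s - c s'‖ ≤ 2 * |s - s'| ∧ |R s - R s'| ≤ 2 * |s - s'|) → (∀ s ∈ Set.Icc t₁ t₂, ρ s ≤ δ * R s ∧ ‖c s‖ + R s ≤ (κ + κ ^ 2) / 2 * s ∧ ∀ j, ‖ξ j s - c s‖ ≤ (1 - δ) * R s ∨ (1 + δ) * R s ≤ ‖ξ j s - c s‖) → ∀ μ : Fin 4, |P t₂ (c t₂) (R t₂) μ - P t₁ (c t₁) (R t₁) μ| ≤ C * ∫ s in t₁..t₂, (R s ^ (3 / 2 :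 ℝ))⁻¹) → (∀ (t : ℝ) (c : E3) (R : ℝ) (A : Finset (Fin N)), T ≤ t → ρ t ≤ δ * R → ‖c‖ + R ≤ (κ + κ ^ 2) / 2 * t → (∀ j, ‖ξ j t - c‖ ≤ (1 - δ) * R ∨ (1 + δ) * R ≤ ‖ξ j t - c‖) → (∀ j, j ∈ A ↔ ‖ξ j t - c‖ ≤ (1 - δ) * R) → |P t c R 0 - ∑ j ∈ A, M j * (√(1 - ‖v j t‖ ^ 2))⁻¹| ≤ ζ t ∧ ∀ k : Fin 3, |P t c R k.succ - ∑ j ∈ A, M j * (√(1 - ‖v j t‖ ^ 2))⁻¹ * v j t k| ≤ ζ t) → (∀ j (s s' : ℝ), T ≤ s → s ≤ s' → ‖ξ j s' - ξ j s‖ ≤ s' - s) → ∀ {t R : ℝ} {c : E3} {A : Finset (Fin N)}, T ≤ t → 0 < R → (∀ s ∈ Set.Icc t (t + δ * R), ρ s ≤ δ * R) → ‖c‖ + R ≤ (κ + κ ^ 2) / 2 * t → (∀ j ∈ A, ‖ξ j t - c‖ ≤ (1 - 2 * δ) * R) → (∀ j ∉ A, (1 + 2 * δ) * R ≤ ‖ξ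 j t - c‖) → ∀ {s : ℝ}, s ∈ Set.Icc t (t + δ * R) → |(∑ j ∈ A, M j * (√(1 - ‖v j s‖ ^ 2))⁻¹) - ∑ j ∈ A, M j * (√(1 - ‖v j t‖ ^ 2))⁻¹| ≤ C * ((s - t) * (R ^ (3 / 2 : ℝ))⁻¹) + ζ t + ζ s ∧ ∀ k : Fin 3, |(∑ j ∈ A, M j * (√(1 - ‖v j s‖ ^ 2))⁻¹ * v j s k) - ∑ j ∈ A, M j * (√(1 - ‖v j t‖ ^ 2))⁻¹ * v j t k| ≤ C * ((s - t) * (R ^ (3 / 2 : ℝ))⁻¹) + ζ t + ζ s :=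
  fun M ξ v κ P _ _ _ _ _ hδ hκ hWL hID hmove _ _ _ _ ht hR hρ hcone hin hout _ hs ↦
    clusterLaw_constPath' M ξ v κ P hδ hκ hWL hID hmove ht hR hρ hcone hin hout hs

end Summit.FinalStateConjecture.FinalStateConjecture.Theorems.SublinearIsFree.Virial

end
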